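import Mathlib
import HarnessLib
import Summits.HubbardSuperconductivity.HubbardSuperconductivity.Theorems.KLProgrammeC4aPPKernelNegPreDiagonal
import Summits.HubbardSuperconductivity.HubbardSuperconductivity.Theorems.KLProgrammeC4aPPKernelTrueNumeratorC2

/-!
# Route `KLProgramme` — crux C4a, S3 brick (B4) «(B4)-UMK1», «(M1)-K2-PACKAGE» part 1: the finer-line SPLIT FACTOR `R(e,u) = κ(e/(e+u))/(e+u)` to second
# order, and the JOINT CONTINUITY of the true numerator and its partner derivative along continuous level maps

Cell `gate-hubbard-kl`, seat hubbard-kl-k3c3-p1 (g16; row «δμ-flow with klAngularMean constant piece»).  Located brick for the (U1) chain of hubbard-kl-k3c3-p3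
(the positive-level `hpre` law `…C4aFoldBoxPreLaw.intervalIntegral_partnerBand_pre_le`, rows `hK : ContDiff ℝ 2`, `hK2`, `hsupp`, `hKc`) / the (C)-closer lane
(stub (C) `stub_twoLeg_curvature` of `KLRegimeEngineV17F2`, stmt-HubbardSuperconductivity-20437); part 2 = `…C4aPPKernelOneSided` (the one-sided split kernel
`K⁺(e,u) = N(e,u)·R(e,u)` for `u > 0`, `0` for `u ≤ 0`, and its rows); memo HOME/hubbard-kl-k3c3-p1/g16-M1-NEG-PRE-KERNEL.md §5.

WHY.  The (N2)-grade rows of the positive-level pre-caustic law ask of the kernel `u ↦ K(e,u)` a SECOND derivative envelope `|K″| ≤ C·max(e,|u|)⁻³`, `C²`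
regularity, the one-sided support `u ≤ q_s·e ⇒ K′ = 0`, and joint continuity of `(e,u) ↦ K′`.  With `K = N·R`, `R(e,u) = κ(e/(e+u))/(e+u)` the finer-line split
factor (g15 `…C4aPPKernelTrueEnvelope`: `𝒦 = N·κ(e/(e+u))/(e+u)`), Leibniz gives `K′ = N′R + NR′`, `K″ = N″R + 2N′R′ + NR″`; the `N`-sizes are landed
(`|N| ≤ 1`, `|N′|(e+u) ≤ (6B₁+5/2)/(1−t₁)` on the support, `|N″| ≤ (64B₂+96B₁+132)/M²` for `M ≤ 2|u|`), so what is needed is the `R`-calculus: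
* §1 (all written out, no definitions: `R = κ(a)/(e+u)`, `R′ = −(κ′(a)a + κ(a))/(e+u)²`, `R″ = (κ″(a)a² + 4κ′(a)a + 2κ(a))/(e+u)³`, `a = e/(e+u)`) **`hasDerivAt_splitR`**,
  **`hasDerivAt_splitR1`** (`e + u ≠ 0`), the sizes **`abs_splitR_le`** `κ₀/(e+u)`, **`abs_splitR1_le`** `(κ₀+κ₁)/(e+u)²`, **`abs_splitR2_le`** `(2κ₀+4κ₁+κ₂)/(e+u)³`
  (`e ≥ 0 < u`), and the vanishing **`splitR_eq_zero_of_le`** once `e/(e+u) ≥ t₁` (`κ = κ′ = κ″ = 0` on `[t₁,∞)`), with the threshold in partner terms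
  `splitRatio_ge_of_le` (`−e < u ≤ e(1−t₁)/t₁ ⟹ t₁ ≤ e/(e+u)`);
* §2 **`continuous_ppTrueKernel_comp`** (`x ↦ P(f x, g x)` continuous: uniformly dominated series), **`ppTrueNumeratorDu_eq_kernel`** (`∂ᵤN = ∂ᵤP·(e+u) + P` EVERYWHERE,
  by uniqueness of the derivative of `N = P·(e+u)`), hence **`continuous_ppTrueNumerator_comp`** and **`continuous_ppTrueNumeratorDu_comp`**: `N` and `∂ᵤN` are
  jointly continuous along any continuous pair of level maps — the input of part 2's `hKc`.
Pure real analysis on Literature objects; nothing asserts (C), K3, the window or superconductivity.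
References: BGM 2006 §2.4 (2.36) [cite: BenfattoGiulianiMastropietro2006]; Salmhofer 1999 §4.2.5 (4.70)–(4.71) [cite: Salmhofer1999];
FST II CPAM 51 (1998) §3 [cite: FeldmanSalmhoferTrubowitz1998].
-/

noncomputable section

namespace Summit.HubbardSuperconductivity.HubbardSuperconductivity.Theorems.C4a

set_option linter.dupNamespace false -- summit = problem name (single-conjunct summit), D-0017

open Real Filter Set
open scoped Topology
open Literature.MathematicalPhysics.QuantumLattice Literature.Analysis.SpecialFunctions

/-! ## §1 The split factor `R(e,u) = κ(e/(e+u))/(e+u)` to second order -/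

/-- The split argument's partner derivative: `d/du [e/(e+u)] = −e/(e+u)²` (`e + u ≠ 0`). [folklore] -/
theorem hasDerivAt_splitRatio {e u : ℝ} (hs : e + u ≠ 0) : HasDerivAt (fun v : ℝ => e / (e + v)) (-e / (e + u) ^ 2) u := by
  have h1 : HasDerivAt (fun v : ℝ => e + v) 1 u := (hasDerivAt_id u).const_add e
  have h2 := (hasDerivAt_const u e).div h1 hs
  refine h2.congr_deriv ?_
  field_simp
  ring

/-- **`∂ᵤR = R′`** (`e + u ≠ 0`). [folklore] -/
theorem hasDerivAt_splitR {κ κ' : ℝ → ℝ} (hκ : ∀ t, HasDerivAt κ (κ' t) t) {e u : ℝ} (hs : e + u ≠ 0) :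
    HasDerivAt (fun v : ℝ => κ (e / (e + v)) / (e + v)) (-(κ' (e / (e + u)) * (e / (e + u)) + κ (e / (e + u))) / (e + u) ^ 2) u := by
  have ha := hasDerivAt_splitRatio hs
  have hκa : HasDerivAt (fun v : ℝ => κ (e / (e + v))) (κ' (e / (e + u)) * (-e / (e + u) ^ 2)) u := (hκ _).comp u ha
  have h1 : HasDerivAt (fun v : ℝ => e + v) 1 u := (hasDerivAt_id u).const_add e
  have h := hκa.div h1 hs
  refine h.congr_deriv ?_
  field_simp
  ring

/-- **`∂ᵤR′ = R″`** (`e + u ≠ 0`). [folklore] -/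
theorem hasDerivAt_splitR1 {κ κ' κ'' : ℝ → ℝ} (hκ : ∀ t, HasDerivAt κ (κ' t) t) (hκ' : ∀ t, HasDerivAt κ' (κ'' t) t) {e u : ℝ} (hs : e + u ≠ 0) :
    HasDerivAt (fun v : ℝ => -(κ' (e / (e + v)) * (e / (e + v)) + κ (e / (e + v))) / (e + v) ^ 2)
      ((κ'' (e / (e + u)) * (e / (e + u)) ^ 2 + 4 * κ' (e / (e + u)) * (e / (e + u)) + 2 * κ (e / (e + u))) / (e + u) ^ 3) u := by
  have ha := hasDerivAt_splitRatio hs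
  have hκa : HasDerivAt (fun v : ℝ => κ (e / (e + v))) (κ' (e / (e + u)) * (-e / (e + u) ^ 2)) u := (hκ _).comp u ha
  have hκ'a : HasDerivAt (fun v : ℝ => κ' (e / (e + v))) (κ'' (e / (e + u)) * (-e / (e + u) ^ 2)) u := (hκ' _).comp u ha
  have hnum : HasDerivAt (fun v : ℝ => κ' (e / (e + v)) * (e / (e + v)) + κ (e / (e + v)))
      (κ'' (e / (e + u)) * (-e / (e + u) ^ 2) * (e / (e + u)) + κ' (e / (e + u)) * (-e / (e + u) ^ 2) + κ' (e / (e + u)) * (-e / (e + u) ^ 2)) u :=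
    (hκ'a.mul ha).add hκa
  have hden : HasDerivAt (fun v : ℝ => (e + v) ^ 2) (2 * (e + u)) u := by
    have h := ((hasDerivAt_id u).const_add e).pow 2
    refine h.congr_deriv ?_
    simp
  have h := (hnum.neg).div hden (pow_ne_zero 2 hs)
  refine h.congr_deriv ?_
  simp only [Pi.neg_apply]
  field_simp
  ring

/-- The split argument lies in `[0,1]` for `e ≥ 0 < u`. [folklore] -/
theorem splitRatio_mem_Icc {e u : ℝ} (he : 0 ≤ e) (hu : 0 < u) : e / (e + u) ∈ Icc (0 : ℝ) 1 :=
  ⟨div_nonneg he (by linarith), (div_le_one (by linarith)).2 (by linarith)⟩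

/-- **`|R| ≤ κ₀/(e+u)`** (`e ≥ 0 < u`, `|κ| ≤ κ₀` on `[0,1]`). [folklore] -/
theorem abs_splitR_le {κ : ℝ → ℝ} {κ₀ : ℝ} (hκb : ∀ t ∈ Icc 0 1, |κ t| ≤ κ₀) {e u : ℝ} (he : 0 ≤ e) (hu : 0 < u) :
    |κ (e / (e + u)) / (e + u)| ≤ κ₀ / (e + u) := by
  have hs : 0 < e + u := by linarith
  rw [abs_div, abs_of_pos hs]
  exact div_le_div_of_nonneg_right (hκb _ (splitRatio_mem_Icc he hu)) hs.le

/-- **`|R′| ≤ (κ₀+κ₁)/(e+u)²`** (`e ≥ 0`, `e + u > 0`). [folklore] -/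
theorem abs_splitR1_le {κ κ' : ℝ → ℝ} {κ₀ κ₁ : ℝ} (hκb : ∀ t ∈ Icc 0 1, |κ t| ≤ κ₀) (hκ'b : ∀ t ∈ Icc 0 1, |κ' t| ≤ κ₁) {e u : ℝ} (he : 0 ≤ e)
    (hu : 0 < u) : |-(κ' (e / (e + u)) * (e / (e + u)) + κ (e / (e + u))) / (e + u) ^ 2| ≤ (κ₀ + κ₁) / (e + u) ^ 2 := by
  have hs : 0 < e + u := by linarith
  have ha := splitRatio_mem_Icc he hu
  set a := e / (e + u) with hadef
  rw [abs_div, abs_neg, abs_of_pos (by positivity : (0 : ℝ) < (e + u) ^ 2)]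
  refine div_le_div_of_nonneg_right ?_ (by positivity)
  have h1 : |κ' a * a| ≤ κ₁ := by
    rw [abs_mul, abs_of_nonneg ha.1]
    calc |κ' a| * a ≤ κ₁ * 1 := mul_le_mul (hκ'b a ha) ha.2 ha.1 ((abs_nonneg _).trans (hκ'b a ha))
      _ = κ₁ := mul_one _
  calc |κ' a * a + κ a| ≤ |κ' a * a| + |κ a| := abs_add_le _ _
    _ ≤ κ₁ + κ₀ := add_le_add h1 (hκb a ha)
    _ = κ₀ + κ₁ := add_comm _ _

/-- **`|R″| ≤ (2κ₀+4κ₁+κ₂)/(e+u)³`** (`e ≥ 0 < u`). [folklore] -/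
theorem abs_splitR2_le {κ κ' κ'' : ℝ → ℝ} {κ₀ κ₁ κ₂ : ℝ} (hκb : ∀ t ∈ Icc 0 1, |κ t| ≤ κ₀) (hκ'b : ∀ t ∈ Icc 0 1, |κ' t| ≤ κ₁)
    (hκ''b : ∀ t ∈ Icc 0 1, |κ'' t| ≤ κ₂) {e u : ℝ} (he : 0 ≤ e) (hu : 0 < u) :
    |(κ'' (e / (e + u)) * (e / (e + u)) ^ 2 + 4 * κ' (e / (e + u)) * (e / (e + u)) + 2 * κ (e / (e + u))) / (e + u) ^ 3| ≤
      (2 * κ₀ + 4 * κ₁ + κ₂) / (e + u) ^ 3 := by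
  have hs : 0 < e + u := by linarith
  have ha := splitRatio_mem_Icc he hu
  set a := e / (e + u) with hadef
  rw [abs_div, abs_of_pos (by positivity : (0 : ℝ) < (e + u) ^ 3)]
  refine div_le_div_of_nonneg_right ?_ (by positivity)
  have hκ₁0 : 0 ≤ κ₁ := (abs_nonneg _).trans (hκ'b a ha)
  have hκ₂0 : 0 ≤ κ₂ := (abs_nonneg _).trans (hκ''b a ha)
  have h1 : |κ'' a * a ^ 2| ≤ κ₂ := by
    rw [abs_mul, abs_of_nonneg (by positivity : (0 : ℝ) ≤ a ^ 2)]
    calc |κ'' a| * a ^ 2 ≤ κ₂ * 1 := mul_le_mul (hκ''b a ha) (by nlinarith [ha.1, ha.2]) (by positivity) hκ₂0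
      _ = κ₂ := mul_one _
  have h2 : |4 * κ' a * a| ≤ 4 * κ₁ := by
    rw [abs_mul, abs_mul, abs_of_pos (by norm_num : (0 : ℝ) < 4), abs_of_nonneg ha.1]
    calc 4 * |κ' a| * a ≤ 4 * κ₁ * 1 := by gcongr; exacts [hκ'b a ha, ha.2]
      _ = 4 * κ₁ := mul_one _
  have h3 : |2 * κ a| ≤ 2 * κ₀ := by
    rw [abs_mul, abs_of_pos (by norm_num : (0 : ℝ) < 2)]; exact mul_le_mul_of_nonneg_left (hκb a ha) (by norm_num)
  calc |κ'' a * a ^ 2 + 4 * κ' a * a + 2 * κ a| ≤ |κ'' a * a ^ 2 + 4 * κ' a * a| + |2 * κ a| := abs_add_le _ _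
    _ ≤ (|κ'' a * a ^ 2| + |4 * κ' a * a|) + |2 * κ a| := by gcongr; exact abs_add_le _ _
    _ ≤ (κ₂ + 4 * κ₁) + 2 * κ₀ := add_le_add (add_le_add h1 h2) h3
    _ = 2 * κ₀ + 4 * κ₁ + κ₂ := by ring

/-- **Vanishing beyond the split threshold**: `κ = κ′ = κ″ = 0` on `[t₁,∞)` and `t₁ ≤ e/(e+u)` ⟹ `R = R′ = R″ = 0`. [folklore] -/
theorem splitR_eq_zero_of_le {κ κ' κ'' : ℝ → ℝ} {t₁ : ℝ} (hκs : ∀ t, t₁ ≤ t → κ t = 0) (hκ's : ∀ t, t₁ ≤ t → κ' t = 0)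
    (hκ''s : ∀ t, t₁ ≤ t → κ'' t = 0) {e u : ℝ} (ha : t₁ ≤ e / (e + u)) :
    κ (e / (e + u)) / (e + u) = 0 ∧ -(κ' (e / (e + u)) * (e / (e + u)) + κ (e / (e + u))) / (e + u) ^ 2 = 0 ∧
      (κ'' (e / (e + u)) * (e / (e + u)) ^ 2 + 4 * κ' (e / (e + u)) * (e / (e + u)) + 2 * κ (e / (e + u))) / (e + u) ^ 3 = 0 := by
  rw [hκs _ ha, hκ's _ ha, hκ''s _ ha]
  simp

/-- The threshold in partner terms: `0 < t₁`, `−e < u ≤ e(1−t₁)/t₁` ⟹ `t₁ ≤ e/(e+u)`. [folklore] -/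
theorem splitRatio_ge_of_le {t₁ e u : ℝ} (ht₀ : 0 < t₁) (hsu : -e < u) (hu : u ≤ e * (1 - t₁) / t₁) : t₁ ≤ e / (e + u) := by
  have hs : 0 < e + u := by linarith
  rw [le_div_iff₀ hs]
  have h1 : t₁ * u ≤ e * (1 - t₁) := by
    have := mul_le_mul_of_nonneg_left hu ht₀.le
    rwa [mul_div_cancel₀ _ ht₀.ne'] at this
  nlinarith

/-! ## §2 Joint continuity of `P`, `N` and `∂ᵤN` along continuous level maps -/

/-- **`x ↦ P(f x, g x)` is continuous for continuous `f, g`** (uniformly dominated series, dominator `abs_ppTrueKernel_summand_le`).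
[cite: BenfattoGiulianiMastropietro2006, §2.4 (2.36)] -/
theorem continuous_ppTrueKernel_comp {β : ℝ} (hβ : 0 < β) (Λ : ℝ) {X : Type*} [TopologicalSpace X] {f g : X → ℝ} (hf : Continuous f) (hg : Continuous g) :
    Continuous fun x : X => ppTrueKernel β Λ (f x) (g x) := by
  unfold ppTrueKernel
  refine continuous_const.mul ?_
  refine continuous_tsum (fun n => ?_) ((summable_one_div_ppFreq_sq_add_sq hβ 0).mul_left 2) fun n x => ?_
  · have hWe : Continuous fun x : X => uvWeightFn Λ (ppFreq β n) (f x) := (continuous_uvWeightFn_level Λ _).comp hf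
    have hWu : Continuous fun x : X => uvWeightFn Λ (ppFreq β n) (g x) := (continuous_uvWeightFn_level Λ _).comp hg
    have hω := ppFreq_pos hβ n
    have hne : ∀ x : X, (ppFreq β n ^ 2 + f x ^ 2) * (ppFreq β n ^ 2 + g x ^ 2) ≠ 0 := fun x => by positivity
    exact (hWe.mul hWu).mul (Continuous.div (by fun_prop) (by fun_prop) hne)
  · rw [Real.norm_eq_abs]
    have h := abs_ppTrueKernel_summand_le hβ Λ (f x) (g x) n
    refine h.trans (le_of_eq ?_)
    have : 0 < ppFreq β n := ppFreq_pos hβ n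
    field_simp

/-- **`∂ᵤN = ∂ᵤP·(e+u) + P` EVERYWHERE** (Leibniz on `N = P·(e+u)` and uniqueness of the derivative). [cite: BenfattoGiulianiMastropietro2006, §2.4 (2.36)] -/
theorem ppTrueNumeratorDu_eq_kernel {β Λ : ℝ} (hβ : 0 < β) (hΛ : 0 < Λ) {B₁ : ℝ} (hB₁ : ∀ x, |deriv salmhoferCutoff x| ≤ B₁) (e u : ℝ) :
    ppTrueNumeratorDu β Λ e u = ppTrueKernelDu β Λ e u * (e + u) + ppTrueKernel β Λ e u := by
  have h1 : HasDerivAt (fun v : ℝ => ppTrueKernel β Λ e v * (e + v)) (ppTrueKernelDu β Λ e u * (e + u) + ppTrueKernel β Λ e u * 1) u :=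
    (hasDerivAt_ppTrueKernel_u hβ hΛ hB₁ e u).mul ((hasDerivAt_id u).const_add e)
  have hfun : (fun v : ℝ => ppTrueKernel β Λ e v * (e + v)) = fun v => ppTrueNumerator β Λ e v := funext fun v => ppTrueKernel_mul hβ Λ e v
  rw [hfun] at h1
  have h2 := hasDerivAt_ppTrueNumerator_u hβ hΛ hB₁ e u
  rw [h2.unique h1, mul_one]

/-- **`x ↦ N(f x, g x)` is continuous** (`N = P·(e+u)`). [cite: BenfattoGiulianiMastropietro2006, §2.4 (2.36)] -/
theorem continuous_ppTrueNumerator_comp {β : ℝ} (hβ : 0 < β) (Λ : ℝ) {X : Type*} [TopologicalSpace X] {f g : X → ℝ} (hf : Continuous f)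
    (hg : Continuous g) : Continuous fun x : X => ppTrueNumerator β Λ (f x) (g x) := by
  have h : (fun x : X => ppTrueNumerator β Λ (f x) (g x)) = fun x => ppTrueKernel β Λ (f x) (g x) * (f x + g x) :=
    funext fun x => (ppTrueKernel_mul hβ Λ (f x) (g x)).symm
  rw [h]
  exact (continuous_ppTrueKernel_comp hβ Λ hf hg).mul (hf.add hg)

/-- **`x ↦ ∂ᵤN(f x, g x)` is continuous** (`∂ᵤN = ∂ᵤP·(e+u) + P`). [cite: BenfattoGiulianiMastropietro2006, §2.4 (2.36)] -/
theorem continuous_ppTrueNumeratorDu_comp {β Λ : ℝ} (hβ : 0 < β) (hΛ : 0 < Λ) {B₁ : ℝ} (hB₁ : ∀ x, |deriv salmhoferCutoff x| ≤ B₁) {X : Type*}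
    [TopologicalSpace X] {f g : X → ℝ} (hf : Continuous f) (hg : Continuous g) : Continuous fun x : X => ppTrueNumeratorDu β Λ (f x) (g x) := by
  have h : (fun x : X => ppTrueNumeratorDu β Λ (f x) (g x)) = fun x => ppTrueKernelDu β Λ (f x) (g x) * (f x + g x) + ppTrueKernel β Λ (f x) (g x) :=
    funext fun x => ppTrueNumeratorDu_eq_kernel hβ hΛ hB₁ (f x) (g x)
  rw [h]
  exact ((continuous_ppTrueKernelDu_comp hβ hΛ hB₁ hf hg).mul (hf.add hg)).add (continuous_ppTrueKernel_comp hβ Λ hf hg)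

end Summit.HubbardSuperconductivity.HubbardSuperconductivity.Theorems.C4a

end
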